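import Mathlib.Algebra.BigOperators.Group.Finset.Basic
import Mathlib.Algebra.BigOperators.Ring.Finset
import Mathlib.Data.Fintype.BigOperators
import Mathlib.Data.Fintype.Card
import Mathlib.Tactic
import HarnessLib

/-!
# Venture HSemireg — flat triangle-free four-coordinate designs at `t = 2d`: complement law, ΣN(C₄) = 6 d⁴, rigidity

Cell `pub-hsemireg`, widening group W5, seat w5-n7-1 (gen 12); files of record `widen/W5/FLATTF-w5n62g17.md` §0 / §3
(THEOREM L: every flat triangle-free four-coordinate design satisfies `12 t d³ ≤ 2 ΣN(C₄) + 3 t² d²`; «Moreover t ≥ 2d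
always, and t = 2d forces the d-fold blow-up of the cube Q₃ (ΣN = 6d⁴)»; §3 «t = 2d: … Ω = 0, ΣN = 6d⁴ …; and
N_C β = C ∖ N_C α for every α ∼ β forces all B-neighbours of α to have the same C- (and D-) neighbourhood, i.e. every
G_YZ is a disjoint union of K_{d,d} blocks compatible across pairs») and `widen/W5/N7-FEASIBILITY-w5n7.md` §3.9 (b)/(d);
tree leg `Summits/Ventures/HSemireg/FlatTriangleFreeFourCycles.lean` (`twelve_mul_le`), whose hypothesis names and
shapes are reused verbatim (`nAB … nDC`, `cBC cBD cCD`, `rXY`, `tABC tABD tACD`, the three cyclic-order sums).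

SETTING. Four level types `α, β, γ, δ` with `t` levels each; six bipartite «torus» graphs by neighbourhood maps
`nXY : X → Finset Y` and transposes; FLAT: every level has exactly `d` neighbours in each graph; TRIANGLE-FREE across
every coordinate triple. This file is the boundary case `t = 2 d` of THEOREM L. What is kernel-checked:

* `two_mul_le_levels` — `2 d ≤ t` as soon as one torus exists (the end-levels of an `XY`-torus have DISJOINT `d`-sets
  of `Z`-neighbours); `compl_law` — at `t = 2d`, along every `XY`-torus `(x, y)`: `nYZ y = (nXZ x)ᶜ`;
* `cyclicSum_eq`, `fourCycles_eq_six_mul` — hence each cyclic-order sum is `2 d⁴` and ΣN(C₄) = 6 d⁴ for EVERY flat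
  triangle-free design with `t = 2d`; `thmL_eq_of_levels_eq_two_mul` — equality in THEOREM L is forced there (the
  companion leg `FlatDesignBlowUp` shows the blown-up cube realises it);
* `nbhd_eq_of_common_neighbour`, `block_eq_transpose`, `block_dichotomy` — BLOCKS: two levels with a common
  neighbour in one coordinate have equal neighbourhoods in every coordinate; the block of `x` is `nYX y` for any
  neighbour `y` (blocks have `d` levels); any two levels have equal or complementary neighbourhoods (every `G_XY` is
  `K_{d,d} ⊔ K_{d,d}`);
* `eq_cubeBlowUp` (with `offBlock_eq`, `mem_iff_block`, `blockA_card`) — RIGIDITY: blocks `SA, SB, SC, SD` exist with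
  `a ∼ b ⟺ (a ∈ SA ↔ b ∈ SB)` for the three pairs through `A` and `b ∼ c ⟺ ¬(b ∈ SB ↔ c ∈ SC)` for the other three —
  the design IS the d-fold blow-up of the cube `Q₃` on antipodal pairs (FLATTF §3), for the kernel.

HONEST FRAMING: finite combinatorics (cardinalities of finsets and complements, constant sums); nothing here is a
statement about a variety, a sheaf or a Hodge class, and nothing in this file says that HC, HC_CM or HC_AV holds; no
door ∕ tier ∕ report sentence of the cell is a consequence of this file alone. This file does not import the tree leg
of THEOREM L (it restates the two sides of its inequality as expressions).
-/

namespace Summit.Ventures.HSemireg.FlatDesignTwiceMargin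

open Finset

section ThreeCoordinates

variable {X Y Z : Type*} [Fintype Z] [DecidableEq Z]

/-- **`t ≥ 2d`.** If `(x, y)` is an `XY`-torus, the `Z`-neighbourhoods of `x` and `y` are disjoint (a common
neighbour closes a triangle), so `d + d ≤ t`. -/
theorem two_mul_le_levels (d t : ℕ) (hZ : Fintype.card Z = t) (nXY : X → Finset Y) (nXZ : X → Finset Z)
    (nYZ : Y → Finset Z) (rXZ : ∀ x, (nXZ x).card = d) (rYZ : ∀ y, (nYZ y).card = d)
    (tXYZ : ∀ x y z, y ∈ nXY x → z ∈ nYZ y → z ∉ nXZ x) (x : X) (y : Y) (hxy : y ∈ nXY x) :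
    2 * d ≤ t := by
  have hdisj : Disjoint (nXZ x) (nYZ y) := Finset.disjoint_right.2 fun z hz => tXYZ x y z hxy hz
  have := card_le_univ (nXZ x ∪ nYZ y)
  rw [card_union_of_disjoint hdisj, rXZ, rYZ, hZ] at this
  omega

/-- **The complement law at `t = 2d`** (FLATTF §3). If `(x, y)` is an `XY`-torus, then `nYZ y` is exactly the
complement of `nXZ x` in `Z`: the two disjoint `d`-sets fill the `2d` levels of `Z`. -/
theorem compl_law (d : ℕ) (hZ : Fintype.card Z = 2 * d) (nXY : X → Finset Y) (nXZ : X → Finset Z)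
    (nYZ : Y → Finset Z) (rXZ : ∀ x, (nXZ x).card = d) (rYZ : ∀ y, (nYZ y).card = d)
    (tXYZ : ∀ x y z, y ∈ nXY x → z ∈ nYZ y → z ∉ nXZ x) (x : X) (y : Y) (hxy : y ∈ nXY x) :
    nYZ y = (nXZ x)ᶜ := by
  refine eq_of_subset_of_card_le (fun z hz => mem_compl.2 (tXYZ x y z hxy hz)) ?_
  rw [card_compl, hZ, rXZ, rYZ]
  omega

/-- The triangle hypothesis read from the torus `(x, z)` of the pair `XZ` with third coordinate `Y`: obtained from
the `XYZ` form and the transpose of `nYZ`. (Used to apply `compl_law` to the pairs `AC`/`AD` with third coordinate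
`B`, and to `AD` with third coordinate `C`, from the four triangle hypotheses of the tree leg.) -/
theorem triangle_swap {W : Type*} (nXY : X → Finset Y) (nXZ : X → Finset W) (nYZ : Y → Finset W)
    (nZY : W → Finset Y) (cYZ : ∀ y z, z ∈ nYZ y ↔ y ∈ nZY z)
    (tXYZ : ∀ x y z, y ∈ nXY x → z ∈ nYZ y → z ∉ nXZ x) :
    ∀ x z y, z ∈ nXZ x → y ∈ nZY z → y ∉ nXY x := by
  intro x z y hz hy hy'
  exact tXYZ x y z hy' ((cYZ y z).2 hy) hz

end ThreeCoordinates

section CyclicSum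

variable {α X Y Z : Type*} [Fintype α] [Fintype Z] [DecidableEq Z]

/-- **One cyclic order at `t = 2d`.** If along every torus `(a, x)` of the first side and `(a, y)` of the second side
the closing neighbourhoods `n₃ x`, `n₄ y` both equal the complement of the `d`-set `n₀ a` in the `2d` levels of `Z`,
then the cyclic-order sum `∑ a, ∑ x ∈ n₁ a, ∑ y ∈ n₂ a, #(n₃ x ∩ n₄ y)` equals `#α · d³`. -/
theorem cyclicSum_eq (d : ℕ) (hZ : Fintype.card Z = 2 * d) (n₀ : α → Finset Z) (n₁ : α → Finset X)
    (n₂ : α → Finset Y) (n₃ : X → Finset Z) (n₄ : Y → Finset Z) (r₀ : ∀ a, (n₀ a).card = d)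
    (r₁ : ∀ a, (n₁ a).card = d) (r₂ : ∀ a, (n₂ a).card = d) (h₃ : ∀ a x, x ∈ n₁ a → n₃ x = (n₀ a)ᶜ)
    (h₄ : ∀ a y, y ∈ n₂ a → n₄ y = (n₀ a)ᶜ) :
    (∑ a, ∑ x ∈ n₁ a, ∑ y ∈ n₂ a, (n₃ x ∩ n₄ y).card) = Fintype.card α * d ^ 3 := by
  have hc : ∀ a, ((n₀ a)ᶜ).card = d := fun a => by
    rw [card_compl, hZ, r₀]; omega
  calc (∑ a, ∑ x ∈ n₁ a, ∑ y ∈ n₂ a, (n₃ x ∩ n₄ y).card) = ∑ a : α, ∑ _x ∈ n₁ a, ∑ _y ∈ n₂ a, d := by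
        refine sum_congr rfl fun a _ => sum_congr rfl fun x hx => sum_congr rfl fun y hy => ?_
        rw [h₃ a x hx, h₄ a y hy, inter_self, hc]
    _ = Fintype.card α * d ^ 3 := by
        simp only [sum_const, smul_eq_mul, r₁, r₂, card_univ]
        ring

end CyclicSum

section FourCoordinates

variable {α β γ δ : Type*} [Fintype α] [Fintype β] [Fintype γ] [Fintype δ]
  [DecidableEq β] [DecidableEq γ] [DecidableEq δ]

/-- **ΣN(C₄) = 6 d⁴ at `t = 2d`.** For every flat triangle-free four-coordinate design whose number of levels is
twice the margin, each of the three cyclic orders `(A B C D)`, `(A B D C)`, `(A C B D)` carries exactly `2 d⁴`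
transversal 4-cycles, so ΣN(C₄) = 6 d⁴. Hypotheses as in `FlatTriangleFreeFourCycles.twelve_mul_le` (transposes
`cBC, cBD, cCD`; all degrees `d`; the four triangle hypotheses) with `t = 2 * d`. -/
theorem fourCycles_eq_six_mul (d : ℕ)
    (hα : Fintype.card α = 2 * d) (hβ : Fintype.card β = 2 * d) (hγ : Fintype.card γ = 2 * d)
    (hδ : Fintype.card δ = 2 * d)
    (nAB : α → Finset β) (nAC : α → Finset γ) (nAD : α → Finset δ)
    (nBC : β → Finset γ) (nCB : γ → Finset β) (nBD : β → Finset δ) (nDB : δ → Finset β)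
    (nCD : γ → Finset δ) (nDC : δ → Finset γ)
    (cBC : ∀ b c, c ∈ nBC b ↔ b ∈ nCB c) (cBD : ∀ b e, e ∈ nBD b ↔ b ∈ nDB e)
    (cCD : ∀ c e, e ∈ nCD c ↔ c ∈ nDC e)
    (rAB : ∀ a, (nAB a).card = d) (rAC : ∀ a, (nAC a).card = d) (rAD : ∀ a, (nAD a).card = d)
    (rBC : ∀ b, (nBC b).card = d) (rCB : ∀ c, (nCB c).card = d) (rBD : ∀ b, (nBD b).card = d)
    (rDB : ∀ e, (nDB e).card = d) (rCD : ∀ c, (nCD c).card = d) (rDC : ∀ e, (nDC e).card = d)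
    (tABC : ∀ a b c, b ∈ nAB a → c ∈ nBC b → c ∉ nAC a)
    (tABD : ∀ a b e, b ∈ nAB a → e ∈ nBD b → e ∉ nAD a)
    (tACD : ∀ a c e, c ∈ nAC a → e ∈ nCD c → e ∉ nAD a) :
    (∑ a, ∑ b ∈ nAB a, ∑ e ∈ nAD a, (nBC b ∩ nDC e).card) = 2 * d ^ 4 ∧
      (∑ a, ∑ b ∈ nAB a, ∑ c ∈ nAC a, (nBD b ∩ nCD c).card) = 2 * d ^ 4 ∧
        (∑ a, ∑ c ∈ nAC a, ∑ e ∈ nAD a, (nCB c ∩ nDB e).card) = 2 * d ^ 4 := by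
  have e24 : Fintype.card α * d ^ 3 = 2 * d ^ 4 := by rw [hα]; ring
  have hBC : ∀ a b, b ∈ nAB a → nBC b = (nAC a)ᶜ :=
    compl_law d hγ nAB nAC nBC rAC rBC tABC
  have hDC : ∀ a e, e ∈ nAD a → nDC e = (nAC a)ᶜ :=
    compl_law d hγ nAD nAC nDC rAC rDC (triangle_swap nAC nAD nCD nDC cCD tACD)
  have hBD : ∀ a b, b ∈ nAB a → nBD b = (nAD a)ᶜ :=
    compl_law d hδ nAB nAD nBD rAD rBD tABD
  have hCD : ∀ a c, c ∈ nAC a → nCD c = (nAD a)ᶜ :=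
    compl_law d hδ nAC nAD nCD rAD rCD tACD
  have hCB : ∀ a c, c ∈ nAC a → nCB c = (nAB a)ᶜ :=
    compl_law d hβ nAC nAB nCB rAB rCB (triangle_swap nAB nAC nBC nCB cBC tABC)
  have hDB : ∀ a e, e ∈ nAD a → nDB e = (nAB a)ᶜ :=
    compl_law d hβ nAD nAB nDB rAB rDB (triangle_swap nAB nAD nBD nDB cBD tABD)
  refine ⟨?_, ?_, ?_⟩
  · rw [cyclicSum_eq d hγ nAC nAB nAD nBC nDC rAC rAB rAD hBC hDC, e24]
  · rw [cyclicSum_eq d hδ nAD nAB nAC nBD nCD rAD rAB rAC hBD hCD, e24]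
  · rw [cyclicSum_eq d hβ nAB nAC nAD nCB nDB rAB rAC rAD hCB hDB, e24]

/-- **Equality in THEOREM L is forced at `t = 2d`.** Under the hypotheses of `fourCycles_eq_six_mul`,
`12 t d³ = 2 ΣN(C₄) + 3 t² d²` with `t = 2d` (both sides are `24 d⁴`): the inequality `twelve_mul_le` of
`Summits/Ventures/HSemireg/FlatTriangleFreeFourCycles.lean` is an identity on the boundary `t = 2d`. -/
theorem thmL_eq_of_levels_eq_two_mul (d : ℕ)
    (hα : Fintype.card α = 2 * d) (hβ : Fintype.card β = 2 * d) (hγ : Fintype.card γ = 2 * d)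
    (hδ : Fintype.card δ = 2 * d)
    (nAB : α → Finset β) (nAC : α → Finset γ) (nAD : α → Finset δ)
    (nBC : β → Finset γ) (nCB : γ → Finset β) (nBD : β → Finset δ) (nDB : δ → Finset β)
    (nCD : γ → Finset δ) (nDC : δ → Finset γ)
    (cBC : ∀ b c, c ∈ nBC b ↔ b ∈ nCB c) (cBD : ∀ b e, e ∈ nBD b ↔ b ∈ nDB e)
    (cCD : ∀ c e, e ∈ nCD c ↔ c ∈ nDC e)
    (rAB : ∀ a, (nAB a).card = d) (rAC : ∀ a, (nAC a).card = d) (rAD : ∀ a, (nAD a).card = d)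
    (rBC : ∀ b, (nBC b).card = d) (rCB : ∀ c, (nCB c).card = d) (rBD : ∀ b, (nBD b).card = d)
    (rDB : ∀ e, (nDB e).card = d) (rCD : ∀ c, (nCD c).card = d) (rDC : ∀ e, (nDC e).card = d)
    (tABC : ∀ a b c, b ∈ nAB a → c ∈ nBC b → c ∉ nAC a)
    (tABD : ∀ a b e, b ∈ nAB a → e ∈ nBD b → e ∉ nAD a)
    (tACD : ∀ a c e, c ∈ nAC a → e ∈ nCD c → e ∉ nAD a) :
    12 * (2 * d) * d ^ 3 =
      2 * ((∑ a, ∑ b ∈ nAB a, ∑ e ∈ nAD a, (nBC b ∩ nDC e).card) +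
            (∑ a, ∑ b ∈ nAB a, ∑ c ∈ nAC a, (nBD b ∩ nCD c).card) +
            (∑ a, ∑ c ∈ nAC a, ∑ e ∈ nAD a, (nCB c ∩ nDB e).card))
        + 3 * (2 * d) ^ 2 * d ^ 2 := by
  obtain ⟨h1, h2, h3⟩ := fourCycles_eq_six_mul d hα hβ hγ hδ nAB nAC nAD nBC nCB nBD nDB nCD nDC cBC cBD cCD
    rAB rAC rAD rBC rCB rBD rDB rCD rDC tABC tABD tACD
  rw [h1, h2, h3]
  ring

end FourCoordinates

section Blocks

variable {X Y Z : Type*} [Fintype Y] [Fintype Z] [DecidableEq Y] [DecidableEq Z]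

/-- **Common neighbour ⇒ equal neighbourhoods** (at `t = 2d`). If two `X`-levels `x, x'` share a `Y`-neighbour `y`,
then by the complement law `nXZ x = (nYZ y)ᶜ = nXZ x'`: they have the same `Z`-neighbourhood — and then, reading
the complement law from a common `Z`-neighbour, also the same `Y`-neighbourhood. -/
theorem nbhd_eq_of_common_neighbour (d : ℕ) (hY : Fintype.card Y = 2 * d) (hZ : Fintype.card Z = 2 * d)
    (nXY : X → Finset Y) (nXZ : X → Finset Z) (nYZ : Y → Finset Z) (nZY : Z → Finset Y)
    (cYZ : ∀ y z, z ∈ nYZ y ↔ y ∈ nZY z)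
    (rXY : ∀ x, (nXY x).card = d) (rXZ : ∀ x, (nXZ x).card = d) (rYZ : ∀ y, (nYZ y).card = d)
    (rZY : ∀ z, (nZY z).card = d) (tXYZ : ∀ x y z, y ∈ nXY x → z ∈ nYZ y → z ∉ nXZ x)
    (x x' : X) (y : Y) (hy : y ∈ nXY x) (hy' : y ∈ nXY x') :
    nXZ x = nXZ x' ∧ nXY x = nXY x' := by
  have hZeq : nXZ x = nXZ x' := by
    have h1 := compl_law d hZ nXY nXZ nYZ rXZ rYZ tXYZ x y hy
    have h2 := compl_law d hZ nXY nXZ nYZ rXZ rYZ tXYZ x' y hy'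
    rw [h1] at h2
    exact compl_injective h2
  refine ⟨hZeq, ?_⟩
  -- a common Z-neighbour exists since d ≥ 1 (x has the neighbour y)
  have hd : 0 < d := by rw [← rXY x]; exact card_pos.2 ⟨y, hy⟩
  obtain ⟨z, hz⟩ : (nXZ x).Nonempty := by rw [← card_pos, rXZ]; exact hd
  have hz' : z ∈ nXZ x' := hZeq ▸ hz
  have tXZY := triangle_swap nXY nXZ nYZ nZY cYZ tXYZ
  have h1 := compl_law d hY nXZ nXY nZY rXY rZY tXZY x z hz
  have h2 := compl_law d hY nXZ nXY nZY rXY rZY tXZY x' z hz'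
  rw [h1] at h2
  exact compl_injective h2

/-- **Blocks.** At `t = 2d`, for a torus `(x, y)` the set of `X`-levels with the same `Y`-neighbourhood as `x` is
exactly `nYX y` (the transpose neighbourhood of `y`); in particular every block has exactly `d` levels. -/
theorem block_eq_transpose [Fintype X] (d : ℕ) (hY : Fintype.card Y = 2 * d) (hZ : Fintype.card Z = 2 * d)
    (nXY : X → Finset Y) (nYX : Y → Finset X) (nXZ : X → Finset Z) (nYZ : Y → Finset Z)
    (nZY : Z → Finset Y) (cXY : ∀ x y, y ∈ nXY x ↔ x ∈ nYX y) (cYZ : ∀ y z, z ∈ nYZ y ↔ y ∈ nZY z)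
    (rXY : ∀ x, (nXY x).card = d) (rXZ : ∀ x, (nXZ x).card = d) (rYZ : ∀ y, (nYZ y).card = d)
    (rZY : ∀ z, (nZY z).card = d) (tXYZ : ∀ x y z, y ∈ nXY x → z ∈ nYZ y → z ∉ nXZ x)
    (x : X) (y : Y) (hy : y ∈ nXY x) :
    univ.filter (fun x' => nXY x' = nXY x) = nYX y := by
  ext x'
  simp only [mem_filter, mem_univ, true_and]
  constructor
  · intro h
    exact (cXY x' y).1 (h ▸ hy)
  · intro h
    exact ((nbhd_eq_of_common_neighbour d hY hZ nXY nXZ nYZ nZY cYZ rXY rXZ rYZ rZY tXYZ x x' y hy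
      ((cXY x' y).2 h)).2).symm

/-- **Block dichotomy: every `G_XY` is `K_{d,d} ⊔ K_{d,d}`.** At `t = 2d`, any two `X`-levels have equal or
complementary `Y`-neighbourhoods (equal iff they share a neighbour). -/
theorem block_dichotomy (d : ℕ) (hY : Fintype.card Y = 2 * d) (hZ : Fintype.card Z = 2 * d)
    (nXY : X → Finset Y) (nXZ : X → Finset Z) (nYZ : Y → Finset Z) (nZY : Z → Finset Y)
    (cYZ : ∀ y z, z ∈ nYZ y ↔ y ∈ nZY z)
    (rXY : ∀ x, (nXY x).card = d) (rXZ : ∀ x, (nXZ x).card = d) (rYZ : ∀ y, (nYZ y).card = d)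
    (rZY : ∀ z, (nZY z).card = d) (tXYZ : ∀ x y z, y ∈ nXY x → z ∈ nYZ y → z ∉ nXZ x) (x x' : X) :
    nXY x' = nXY x ∨ nXY x' = (nXY x)ᶜ := by
  by_cases h : ∃ y, y ∈ nXY x' ∧ y ∈ nXY x
  · obtain ⟨y, hy⟩ := h
    exact Or.inl (nbhd_eq_of_common_neighbour d hY hZ nXY nXZ nYZ nZY cYZ rXY rXZ rYZ rZY tXYZ x' x y
      hy.1 hy.2).2
  · refine Or.inr (eq_of_subset_of_card_le (fun y hy => mem_compl.2 fun hy' => h ⟨y, hy, hy'⟩) ?_)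
    rw [card_compl, hY, rXY, rXY]
    omega

end Blocks

section Rigidity

variable {α β γ δ : Type*} [Fintype α] [Fintype β] [Fintype γ] [Fintype δ]
  [DecidableEq β] [DecidableEq γ] [DecidableEq δ]

/-- Off-block tori (pairs `BC`, `BD`, `CD`): if every level of a `d`-set `SY ⊆ Y` has `Z`-neighbourhood `SZᶜ` for a
`d`-set `SZ`, then every level of `Y` outside `SY` has `Z`-neighbourhood exactly `SZ` (each `z ∉ SZ` already has
its `d` neighbours inside `SY`). -/
theorem offBlock_eq {Y Z : Type*} [Fintype Z] [DecidableEq Y] [DecidableEq Z] (d : ℕ)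
    (nYZ : Y → Finset Z) (nZY : Z → Finset Y) (cYZ : ∀ y z, z ∈ nYZ y ↔ y ∈ nZY z)
    (rYZ : ∀ y, (nYZ y).card = d) (rZY : ∀ z, (nZY z).card = d) (SY : Finset Y) (SZ : Finset Z)
    (hSY : SY.card = d) (hSZ : SZ.card = d) (hblock : ∀ y ∈ SY, nYZ y = SZᶜ) (y : Y) (hy : y ∉ SY) :
    nYZ y = SZ := by
  have hcol : ∀ z, z ∉ SZ → nZY z = SY := fun z hz => Eq.symm <|
    eq_of_subset_of_card_le (fun y' hy' => (cYZ y' z).1 (by rw [hblock y' hy']; exact mem_compl.2 hz))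
      (by rw [rZY, hSY])
  refine eq_of_subset_of_card_le (fun z hz => ?_) (by rw [rYZ, hSZ])
  by_contra hzS
  exact hy (hcol z hzS ▸ (cYZ y z).1 hz)

/-- Membership in a set that is a given block `T` or its complement: `y ∈ S ↔ (S = T ↔ y ∈ T)` (for `T ≠ ∅`). -/
theorem mem_iff_block {Y : Type*} [Fintype Y] [DecidableEq Y] (S T : Finset Y) (hT : T.Nonempty)
    (h : S = T ∨ S = Tᶜ) (y : Y) : y ∈ S ↔ (S = T ↔ y ∈ T) := by
  rcases h with rfl | rfl
  · exact ⟨fun hy => ⟨fun _ => hy, fun _ => rfl⟩, fun h' => h'.1 rfl⟩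
  · have hne : Tᶜ ≠ T := by
      intro he
      obtain ⟨t, ht⟩ := hT
      exact (mem_compl.1 (he.symm ▸ ht : t ∈ Tᶜ)) ht
    rw [mem_compl]
    exact ⟨fun hy => ⟨fun he => absurd he hne, fun hy' => absurd hy' hy⟩, fun h' hy' => hne (h'.2 hy')⟩

/-- **RIGIDITY at `t = 2d`: the design is the d-fold blow-up of the cube `Q₃`** (FLATTF §3 «every G_YZ is a disjoint
union of K_{d,d} blocks compatible across pairs — the d-fold blow-up of the (1, 2) design, which is the cube Q₃ with
its four antipodal pairs as coordinates»). Under the hypotheses of `twelve_mul_le` with `t = 2d` there are blocks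
`SA ⊆ A`, `SB ⊆ B`, `SC ⊆ C`, `SD ⊆ D` (the last three of size `d`; all empty if `d = 0`) such that the six graphs are
EXACTLY: `a ∼ b ⟺ (a ∈ SA ↔ b ∈ SB)`, `a ∼ c ⟺ (a ∈ SA ↔ c ∈ SC)`, `a ∼ e ⟺ (a ∈ SA ↔ e ∈ SD)` (pairs through `A`
join equal blocks) and `b ∼ c ⟺ ¬(b ∈ SB ↔ c ∈ SC)`, `b ∼ e ⟺ ¬(b ∈ SB ↔ e ∈ SD)`, `c ∼ e ⟺ ¬(c ∈ SC ↔ e ∈ SD)`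
(the other pairs join opposite blocks) — the adjacency of `Q₃` on antipodal pairs (`nAB = nAC = nAD = {·}`,
`nBC = nBD = nCD = (· + 1)` in the companion leg `FlatDesignBlowUp`), blown up. The size of `SA` is not determined
by these hypotheses (they carry no `A`-degrees of `B`-, `C`-, `D`-levels); see `blockA_card`. -/
theorem eq_cubeBlowUp (d : ℕ)
    (hα : Fintype.card α = 2 * d) (hβ : Fintype.card β = 2 * d) (hγ : Fintype.card γ = 2 * d)
    (hδ : Fintype.card δ = 2 * d)
    (nAB : α → Finset β) (nAC : α → Finset γ) (nAD : α → Finset δ)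
    (nBC : β → Finset γ) (nCB : γ → Finset β) (nBD : β → Finset δ) (nDB : δ → Finset β)
    (nCD : γ → Finset δ) (nDC : δ → Finset γ)
    (cBC : ∀ b c, c ∈ nBC b ↔ b ∈ nCB c) (cBD : ∀ b e, e ∈ nBD b ↔ b ∈ nDB e)
    (cCD : ∀ c e, e ∈ nCD c ↔ c ∈ nDC e)
    (rAB : ∀ a, (nAB a).card = d) (rAC : ∀ a, (nAC a).card = d) (rAD : ∀ a, (nAD a).card = d)
    (rBC : ∀ b, (nBC b).card = d) (rCB : ∀ c, (nCB c).card = d) (rBD : ∀ b, (nBD b).card = d)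
    (rDB : ∀ e, (nDB e).card = d) (rCD : ∀ c, (nCD c).card = d) (rDC : ∀ e, (nDC e).card = d)
    (tABC : ∀ a b c, b ∈ nAB a → c ∈ nBC b → c ∉ nAC a)
    (tABD : ∀ a b e, b ∈ nAB a → e ∈ nBD b → e ∉ nAD a)
    (tACD : ∀ a c e, c ∈ nAC a → e ∈ nCD c → e ∉ nAD a) :
    ∃ (SA : Finset α) (SB : Finset β) (SC : Finset γ) (SD : Finset δ),
      (d = 0 ∨ (SB.card = d ∧ SC.card = d ∧ SD.card = d)) ∧
      (∀ a b, b ∈ nAB a ↔ (a ∈ SA ↔ b ∈ SB)) ∧ (∀ a c, c ∈ nAC a ↔ (a ∈ SA ↔ c ∈ SC)) ∧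
      (∀ a e, e ∈ nAD a ↔ (a ∈ SA ↔ e ∈ SD)) ∧
      (∀ b c, c ∈ nBC b ↔ ¬ (b ∈ SB ↔ c ∈ SC)) ∧ (∀ b e, e ∈ nBD b ↔ ¬ (b ∈ SB ↔ e ∈ SD)) ∧
      (∀ c e, e ∈ nCD c ↔ ¬ (c ∈ SC ↔ e ∈ SD)) := by
  classical
  rcases Nat.eq_zero_or_pos d with rfl | hd
  · -- no levels at all: everything is vacuous
    have eα : IsEmpty α := Fintype.card_eq_zero_iff.1 (by rw [hα])
    have eβ : IsEmpty β := Fintype.card_eq_zero_iff.1 (by rw [hβ])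
    have eγ : IsEmpty γ := Fintype.card_eq_zero_iff.1 (by rw [hγ])
    exact ⟨∅, ∅, ∅, ∅, Or.inl rfl, fun a => (IsEmpty.false a).elim, fun a => (IsEmpty.false a).elim,
      fun a => (IsEmpty.false a).elim, fun b => (IsEmpty.false b).elim, fun b => (IsEmpty.false b).elim,
      fun c => (IsEmpty.false c).elim⟩
  -- d ≥ 1: pick a level a₀ of A; its three neighbourhoods are the blocks of B, C, D
  obtain ⟨a₀⟩ := Fintype.card_pos_iff.1 (by rw [hα]; omega : 0 < Fintype.card α)
  have ne : ∀ a, (nAB a).Nonempty ∧ (nAC a).Nonempty ∧ (nAD a).Nonempty := fun a =>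
    ⟨by rw [← card_pos, rAB]; exact hd, by rw [← card_pos, rAC]; exact hd, by rw [← card_pos, rAD]; exact hd⟩
  -- triangle hypotheses read from the other tori, reversed transposes
  have tACB := triangle_swap nAB nAC nBC nCB cBC tABC
  have tADB := triangle_swap nAB nAD nBD nDB cBD tABD
  have tADC := triangle_swap nAC nAD nCD nDC cCD tACD
  have cCB : ∀ c b, b ∈ nCB c ↔ c ∈ nBC b := fun c b => (cBC b c).symm
  have cDB : ∀ e b, b ∈ nDB e ↔ e ∈ nBD b := fun e b => (cBD b e).symm
  have cDC : ∀ e c, c ∈ nDC e ↔ e ∈ nCD c := fun e c => (cCD c e).symm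
  -- the three dichotomies through A, and the links between them (common neighbour ⇒ equal neighbourhoods)
  have dB : ∀ a, nAB a = nAB a₀ ∨ nAB a = (nAB a₀)ᶜ := fun a =>
    block_dichotomy d hβ hγ nAB nAC nBC nCB cBC rAB rAC rBC rCB tABC a₀ a
  have dC : ∀ a, nAC a = nAC a₀ ∨ nAC a = (nAC a₀)ᶜ := fun a =>
    block_dichotomy d hγ hδ nAC nAD nCD nDC cCD rAC rAD rCD rDC tACD a₀ a
  have dD : ∀ a, nAD a = nAD a₀ ∨ nAD a = (nAD a₀)ᶜ := fun a =>
    block_dichotomy d hδ hγ nAD nAC nDC nCD cDC rAD rAC rDC rCD tADC a₀ a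
  have linkBC : ∀ a, nAB a = nAB a₀ ↔ nAC a = nAC a₀ := fun a =>
    ⟨fun h => by
      obtain ⟨b, hb⟩ := (ne a).1
      exact (nbhd_eq_of_common_neighbour d hβ hγ nAB nAC nBC nCB cBC rAB rAC rBC rCB tABC a a₀ b hb
        (h ▸ hb)).1,
     fun h => by
      obtain ⟨c, hc⟩ := (ne a).2.1
      exact (nbhd_eq_of_common_neighbour d hγ hβ nAC nAB nCB nBC cCB rAC rAB rCB rBC tACB a a₀ c hc
        (h ▸ hc)).1⟩
  have linkBD : ∀ a, nAB a = nAB a₀ ↔ nAD a = nAD a₀ := fun a =>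
    ⟨fun h => by
      obtain ⟨b, hb⟩ := (ne a).1
      exact (nbhd_eq_of_common_neighbour d hβ hδ nAB nAD nBD nDB cBD rAB rAD rBD rDB tABD a a₀ b hb
        (h ▸ hb)).1,
     fun h => by
      obtain ⟨e, he⟩ := (ne a).2.2
      exact (nbhd_eq_of_common_neighbour d hδ hβ nAD nAB nDB nBD cDB rAD rAB rDB rBD tADB a a₀ e he
        (h ▸ he)).1⟩
  -- the complement law along the tori at a₀
  have hBC0 : ∀ b ∈ nAB a₀, nBC b = (nAC a₀)ᶜ := fun b hb => compl_law d hγ nAB nAC nBC rAC rBC tABC a₀ b hb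
  have hBD0 : ∀ b ∈ nAB a₀, nBD b = (nAD a₀)ᶜ := fun b hb => compl_law d hδ nAB nAD nBD rAD rBD tABD a₀ b hb
  have hCD0 : ∀ c ∈ nAC a₀, nCD c = (nAD a₀)ᶜ := fun c hc => compl_law d hδ nAC nAD nCD rAD rCD tACD a₀ c hc
  refine ⟨univ.filter (fun a => nAB a = nAB a₀), nAB a₀, nAC a₀, nAD a₀, Or.inr ⟨rAB a₀, rAC a₀, rAD a₀⟩,
    fun a b => ?_, fun a c => ?_, fun a e => ?_, fun b c => ?_, fun b e => ?_, fun c e => ?_⟩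
  · rw [mem_filter, and_iff_right (mem_univ a)]
    exact mem_iff_block _ _ (ne a₀).1 (dB a) b
  · rw [mem_filter, and_iff_right (mem_univ a), linkBC a]
    exact mem_iff_block _ _ (ne a₀).2.1 (dC a) c
  · rw [mem_filter, and_iff_right (mem_univ a), linkBD a]
    exact mem_iff_block _ _ (ne a₀).2.2 (dD a) e
  · by_cases hb : b ∈ nAB a₀
    · rw [hBC0 b hb, mem_compl]
      exact ⟨fun hc h' => hc (h'.1 hb), fun h' hc => h' ⟨fun _ => hc, fun _ => hb⟩⟩
    · rw [offBlock_eq d nBC nCB cBC rBC rCB (nAB a₀) (nAC a₀) (rAB a₀) (rAC a₀) hBC0 b hb]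
      exact ⟨fun hc h' => hb (h'.2 hc), fun h' => by_contra fun hc => h' ⟨fun h => absurd h hb,
        fun h => absurd h hc⟩⟩
  · by_cases hb : b ∈ nAB a₀
    · rw [hBD0 b hb, mem_compl]
      exact ⟨fun he h' => he (h'.1 hb), fun h' he => h' ⟨fun _ => he, fun _ => hb⟩⟩
    · rw [offBlock_eq d nBD nDB cBD rBD rDB (nAB a₀) (nAD a₀) (rAB a₀) (rAD a₀) hBD0 b hb]
      exact ⟨fun he h' => hb (h'.2 he), fun h' => by_contra fun he => h' ⟨fun h => absurd h hb,
        fun h => absurd h he⟩⟩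
  · by_cases hc : c ∈ nAC a₀
    · rw [hCD0 c hc, mem_compl]
      exact ⟨fun he h' => he (h'.1 hc), fun h' he => h' ⟨fun _ => he, fun _ => hc⟩⟩
    · rw [offBlock_eq d nCD nDC cCD rCD rDC (nAC a₀) (nAD a₀) (rAC a₀) (rAD a₀) hCD0 c hc]
      exact ⟨fun he h' => hc (h'.2 he), fun h' => by_contra fun he => h' ⟨fun h => absurd h hc,
        fun h => absurd h he⟩⟩

/-- With the transpose `nBA` of `nAB` (every `B`-level has `d` neighbours in `A`) the `A`-block is determined too:
it is `nBA b₀` for any `b₀ ∈ nAB a₀`, so all four blocks have exactly `d` of the `2d` levels. -/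
theorem blockA_card (d : ℕ) (hβ : Fintype.card β = 2 * d) (hγ : Fintype.card γ = 2 * d)
    (nAB : α → Finset β) (nBA : β → Finset α) (nAC : α → Finset γ) (nBC : β → Finset γ) (nCB : γ → Finset β)
    (cAB : ∀ a b, b ∈ nAB a ↔ a ∈ nBA b) (cBC : ∀ b c, c ∈ nBC b ↔ b ∈ nCB c)
    (rAB : ∀ a, (nAB a).card = d) (rBA : ∀ b, (nBA b).card = d) (rAC : ∀ a, (nAC a).card = d)
    (rBC : ∀ b, (nBC b).card = d) (rCB : ∀ c, (nCB c).card = d)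
    (tABC : ∀ a b c, b ∈ nAB a → c ∈ nBC b → c ∉ nAC a) (a₀ : α) (hd : 0 < d) :
    (univ.filter (fun a => nAB a = nAB a₀)).card = d := by
  classical
  obtain ⟨b₀, hb₀⟩ : (nAB a₀).Nonempty := by rw [← card_pos, rAB]; exact hd
  rw [block_eq_transpose d hβ hγ nAB nBA nAC nBC nCB cAB cBC rAB rAC rBC rCB tABC a₀ b₀ hb₀, rBA]

end Rigidity

end Summit.Ventures.HSemireg.FlatDesignTwiceMargin
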